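import Mathlib.Analysis.Calculus.Deriv.MeanValue
import Literature.MathematicalPhysics.QuantumLattice.WilsonFeynmanHellmann
import Literature.MathematicalPhysics.QuantumFieldTheory.YangMillsOS
import Literature.MathematicalPhysics.QuantumFieldTheory.LatticeGaugeProofs

/-!
# Line `beta-slope-floor` (crux `IR`, stmt-QuantumFields-19354): transport in the coupling — `stub_gronwall` PROVED

Route `BalabanLadder`, crux `IR` (`Summit.QuantumFields.YangMills.Theses.BalabanLadder.IR`), line
`beta-slope-floor` (ideator ym-ir-idea-2; skeleton `Cruxes/IR/Lines/beta_slope_floor.lean`), lead prover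
`ym-ir-line-bsf-p1`.  This module discharges the registered stub `stub_gronwall` (M) of that skeleton and
provides the two group-blind, class-blind tools every version of the line's "slope floor ⇒ window
domination" step uses:

* §1 `hasDerivAt_latticeConnectedCorr` — the statement's connected torus correlator
  `b ↦ latticeConnectedCorr r.ρ b S A B n` is differentiable in the bare coupling at every real `b`, for
  every pair of bounded measurable observables `A, B` of the `ℤ⁴` gauge field and every torus side `S`
  (Feynman–Hellmann for Wilson's lattice gauge theory, tree `hasDerivAt_integral_wilsonMeasure`: the torus
  state is the Gibbs reweighting of product Haar measure by the bounded Wilson action).  So the `deriv` in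
  the line's `SlopeFloor` and in its rung is the true derivative, never a junk value.
* §2 `le_exp_mul_of_mul_le_deriv` — calculus on a unit window: if `f` is differentiable on `[β, β+1]` and
  `l · f ≤ f'` there, then `f β ≤ e^{-l} f (β+1)` (monotonicity of `x ↦ e^{-l (x-β)} f x`; NO sign
  assumption on `f`).
* §3 `latticeConnectedCorr_le_exp_mul_of_floor` — §1 + §2 for the correlator.
* §4 `stub_gronwall` — the registered stub VERBATIM with the skeleton's `IsSliceObs`, `diagCorr`,
  `SlopeFloor`, `WindowDomination` δ-unfolded (the skeleton keeps those `def`s; no proposition is defined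
  here): `(∀ β, 0 < a β) → SlopeFloor r a → WindowDomination r a`, with window constant `e^{K_A}`.

Honest framing: pure plumbing (calculus + Feynman–Hellmann); nothing here bears on the Yang–Mills mass gap
(Clay), on `SlopeFloor` itself (the XL stub, open), or on weak coupling.  R4 of the ladder closes only the
conditional finite-𝕋⁴ rung `BalabanLadder.UV`.
Refs: B. Simon, *The Statistical Mechanics of Lattice Gases* I (1993) §II.1 (fluctuation–response);
E. Seiler, LNP 159 (1982) Ch. 1–2; line card `Cruxes/IR/Lines/beta-slope-floor.md`.
-/

set_option autoImplicit false

noncomputable section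

open MeasureTheory Filter Topology
open Literature.MathematicalPhysics.QuantumFieldTheory Literature.MathematicalPhysics.QuantumLattice

namespace Summit.QuantumFields.YangMills.Cruxes.IR.BetaSlopeFloor

/-! ## §1 Feynman–Hellmann: the statement's correlator is differentiable in the coupling -/

section FeynmanHellmann

variable {G : Type} [Group G] [TopologicalSpace G] [IsTopologicalGroup G] [CompactSpace G]
  [MeasurableSpace G] [BorelSpace G]

/-- **The connected torus correlator is differentiable in the bare coupling.**  For a faithful lattice
representation `r` (which makes `G` second countable), a torus side `S`, bounded measurable observables
`A, B` of the `ℤ⁴` gauge field and a time separation `n`, the map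
`b ↦ latticeConnectedCorr r.ρ b S A B n = ⟨A·τₙB⟩_b − ⟨A⟩_b⟨B⟩_b` has a derivative at every real `b`
(each of the three Wilson expectations does, by `hasDerivAt_integral_wilsonMeasure`). -/
theorem hasDerivAt_latticeConnectedCorr (r : LatticeRep G) (S : ℕ) [NeZero S]
    {A B : LGConfig 4 G → ℝ} (hAm : Measurable A) (hBm : Measurable B) {CA CB : ℝ}
    (hA : ∀ U, |A U| ≤ CA) (hB : ∀ U, |B U| ≤ CB) (n : ℕ) (b : ℝ) :
    ∃ D : ℝ, HasDerivAt (fun b' => latticeConnectedCorr r.ρ b' S A B n) D b := by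
  haveI : SecondCountableTopology G :=
    (r.continuous.isClosedEmbedding r.injective).isEmbedding.secondCountableTopology
  have hFm : Measurable fun U : GaugeConfig 4 S G => A (torusLift S U) :=
    hAm.comp (measurable_torusLift S)
  have hBsm : Measurable fun U : GaugeConfig 4 S G =>
      B (configShift (-Pi.single 0 (n : ℤ)) (torusLift S U)) :=
    hBm.comp ((configShift _).measurable.comp (measurable_torusLift _))
  have hB₀m : Measurable fun U : GaugeConfig 4 S G => B (torusLift S U) :=
    hBm.comp (measurable_torusLift S)
  have hCA0 : 0 ≤ CA := le_trans (abs_nonneg _) (hA fun _ => 1)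
  have h1 := hasDerivAt_integral_wilsonMeasure (d := 4) (L := S) (ρ := r.ρ) r.continuous
    (F := fun U : GaugeConfig 4 S G =>
      A (torusLift S U) * B (configShift (-Pi.single 0 (n : ℤ)) (torusLift S U)))
    (C := CA * CB) (hFm.mul hBsm).aestronglyMeasurable
    (ae_of_all _ fun U => by
      rw [Real.norm_eq_abs, abs_mul]
      exact mul_le_mul (hA _) (hB _) (abs_nonneg _) hCA0) b
  have h2 := hasDerivAt_integral_wilsonMeasure (d := 4) (L := S) (ρ := r.ρ) r.continuous
    (F := fun U : GaugeConfig 4 S G => A (torusLift S U)) (C := CA) hFm.aestronglyMeasurable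
    (ae_of_all _ fun U => by rw [Real.norm_eq_abs]; exact hA _) b
  have h3 := hasDerivAt_integral_wilsonMeasure (d := 4) (L := S) (ρ := r.ρ) r.continuous
    (F := fun U : GaugeConfig 4 S G => B (torusLift S U)) (C := CB) hB₀m.aestronglyMeasurable
    (ae_of_all _ fun U => by rw [Real.norm_eq_abs]; exact hB _) b
  have key : (fun b' => latticeConnectedCorr r.ρ b' S A B n) = fun b' =>
      (∫ U, A (torusLift S U) * B (configShift (-Pi.single 0 (n : ℤ)) (torusLift S U))
          ∂(wilsonMeasure (d := 4) (L := S) r.ρ b')) -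
        (∫ U, A (torusLift S U) ∂(wilsonMeasure (d := 4) (L := S) r.ρ b')) *
          ∫ U, B (torusLift S U) ∂(wilsonMeasure (d := 4) (L := S) r.ρ b') := by
    funext b'
    simp only [latticeConnectedCorr]
  rw [key]
  exact ⟨_, h1.sub (h2.mul h3)⟩

/-- The correlator is differentiable in the coupling at every point. -/
theorem differentiableAt_latticeConnectedCorr (r : LatticeRep G) (S : ℕ) [NeZero S]
    {A B : LGConfig 4 G → ℝ} (hAm : Measurable A) (hBm : Measurable B) {CA CB : ℝ}
    (hA : ∀ U, |A U| ≤ CA) (hB : ∀ U, |B U| ≤ CB) (n : ℕ) (b : ℝ) :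
    DifferentiableAt ℝ (fun b' => latticeConnectedCorr r.ρ b' S A B n) b := by
  obtain ⟨D, hD⟩ := hasDerivAt_latticeConnectedCorr r S hAm hBm hA hB n b
  exact hD.differentiableAt

end FeynmanHellmann

/-! ## §2 Transport on a unit window (calculus) -/

/-- **Grönwall on a unit window, multiplicative form.**  If `f` is differentiable at every point of
`[β, β+1]` and `l · f x ≤ f' x` there, then `f β ≤ e^{-l} · f (β + 1)`.  Proof: `x ↦ e^{-l (x - β)} f x`
has derivative `e^{-l (x-β)} (f' x - l f x) ≥ 0`, hence is monotone on the window.  No sign condition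
on `f` is needed. -/
theorem le_exp_mul_of_mul_le_deriv {f : ℝ → ℝ} {β l : ℝ}
    (hf : ∀ x ∈ Set.Icc β (β + 1), DifferentiableAt ℝ f x)
    (hfl : ∀ x ∈ Set.Icc β (β + 1), l * f x ≤ deriv f x) :
    f β ≤ Real.exp (-l) * f (β + 1) := by
  set g : ℝ → ℝ := fun x => Real.exp (-l * (x - β)) * f x with hg
  have hexp : ∀ x, HasDerivAt (fun y => Real.exp (-l * (y - β)))
      (Real.exp (-l * (x - β)) * -l) x := by
    intro x
    have h1 : HasDerivAt (fun y : ℝ => -l * (y - β)) (-l) x := by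
      simpa using ((hasDerivAt_id x).sub_const β).const_mul (-l)
    exact h1.exp
  have hgd : ∀ x ∈ Set.Icc β (β + 1),
      HasDerivAt g (Real.exp (-l * (x - β)) * -l * f x +
        Real.exp (-l * (x - β)) * deriv f x) x := fun x hx =>
    (hexp x).mul (hf x hx).hasDerivAt
  have hmono : MonotoneOn g (Set.Icc β (β + 1)) := by
    refine monotoneOn_of_deriv_nonneg (convex_Icc β (β + 1)) ?_ ?_ ?_
    · exact fun x hx => (hgd x hx).continuousAt.continuousWithinAt
    · intro x hx
      exact (hgd x (interior_subset hx)).differentiableAt.differentiableWithinAt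
    · intro x hx
      have hx' : x ∈ Set.Icc β (β + 1) := interior_subset hx
      rw [(hgd x hx').deriv]
      have hpos : 0 < Real.exp (-l * (x - β)) := Real.exp_pos _
      have key : Real.exp (-l * (x - β)) * -l * f x + Real.exp (-l * (x - β)) * deriv f x =
          Real.exp (-l * (x - β)) * (deriv f x - l * f x) := by ring
      rw [key]
      exact mul_nonneg hpos.le (by linarith [hfl x hx'])
  have hβ : β ∈ Set.Icc β (β + 1) := ⟨le_rfl, by linarith⟩
  have hβ1 : β + 1 ∈ Set.Icc β (β + 1) := ⟨by linarith, le_rfl⟩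
  have h := hmono hβ hβ1 (by linarith)
  simp only [hg, sub_self, mul_zero, Real.exp_zero, one_mul, add_sub_cancel_left,
    mul_one] at h
  exact h

/-! ## §3 Window transport of the correlator -/

section Window

variable {G : Type} [Group G] [TopologicalSpace G] [IsTopologicalGroup G] [CompactSpace G]
  [MeasurableSpace G] [BorelSpace G]

/-- **Window transport.**  If on the unit window `b ∈ [β, β+1]` the slope floor
`l · c_b ≤ ∂_b c_b` holds for the correlator `c_b = latticeConnectedCorr r.ρ b S A B n` of two bounded
measurable observables, then `c_β ≤ e^{-l} · c_{β+1}`. -/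
theorem latticeConnectedCorr_le_exp_mul_of_floor (r : LatticeRep G) (S : ℕ) [NeZero S]
    {A B : LGConfig 4 G → ℝ} (hAm : Measurable A) (hBm : Measurable B) {CA CB : ℝ}
    (hA : ∀ U, |A U| ≤ CA) (hB : ∀ U, |B U| ≤ CB) (n : ℕ) {β l : ℝ}
    (hfl : ∀ b : ℝ, β ≤ b → b ≤ β + 1 →
      l * latticeConnectedCorr r.ρ b S A B n ≤
        deriv (fun b' => latticeConnectedCorr r.ρ b' S A B n) b) :
    latticeConnectedCorr r.ρ β S A B n ≤
      Real.exp (-l) * latticeConnectedCorr r.ρ (β + 1) S A B n :=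
  le_exp_mul_of_mul_le_deriv (f := fun b' => latticeConnectedCorr r.ρ b' S A B n)
    (fun x _ => differentiableAt_latticeConnectedCorr r S hAm hBm hA hB n x)
    (fun x hx => hfl x hx.1 hx.2)

end Window

/-! ## §4 The registered stub `stub_gronwall` -/

/-- **STUB 2 of line `beta-slope-floor` — GRÖNWALL ON THE UNIT WINDOW (registered signature, with the
skeleton's `IsSliceObs`, `diagCorr`, `SlopeFloor`, `WindowDomination` δ-unfolded).**  For every compact `G`,
every lattice representation `r` and every unit map `a`: the β-slope floor
`(c·a(β)·n − K_A) · D_b(A;S,n) ≤ ∂_b D_b(A;S,n)` on the unit windows `b ∈ [β, β+1]` (all slice species `A`,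
`β ≥ β₂`, `S ≥ S₁ β`, `n ≤ S`) integrates to the window domination
`D_β(A;S,n) ≤ e^{K_A} · e^{−c a(β) n} · D_{β+1}(A;S,n)` with the SAME `c, β₂, S₁`
(`D_b(A;S,n) = latticeConnectedCorr r.ρ b (2S+1) A.F A.F n`; differentiability from §1, transport from
§2; the positivity hypothesis on `a` is not used).  Group-blind plumbing; carries no gap content. -/
theorem stub_gronwall : ∀ (G : Type) [Group G] [TopologicalSpace G] [IsTopologicalGroup G]
    [CompactSpace G] [MeasurableSpace G] [BorelSpace G] (r : LatticeRep G) (a : ℝ → ℝ),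
    (∀ β, 0 < a β) →
    (∃ (c β₂ : ℝ) (S₁ : ℝ → ℕ), 0 < c ∧ ∀ A : YMSpecies G, (∀ e ∈ A.supp, e.1 0 = 0 ∧ e.2 ≠ 0) →
      ∃ K : ℝ, ∀ β : ℝ, β₂ ≤ β → ∀ S n : ℕ, S₁ β ≤ S → n ≤ S → ∀ b : ℝ, β ≤ b → b ≤ β + 1 →
        (c * a β * n - K) * latticeConnectedCorr r.ρ b (2 * S + 1) A.F A.F n ≤
          deriv (fun b' => latticeConnectedCorr r.ρ b' (2 * S + 1) A.F A.F n) b) →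
    (∃ (c β₂ : ℝ) (S₁ : ℝ → ℕ), 0 < c ∧ ∀ A : YMSpecies G, (∀ e ∈ A.supp, e.1 0 = 0 ∧ e.2 ≠ 0) →
      ∃ K : ℝ, ∀ β : ℝ, β₂ ≤ β → ∀ S n : ℕ, S₁ β ≤ S → n ≤ S →
        latticeConnectedCorr r.ρ β (2 * S + 1) A.F A.F n ≤
          K * Real.exp (-(c * a β * n)) *
            latticeConnectedCorr r.ρ (β + 1) (2 * S + 1) A.F A.F n) := by
  intro G _ _ _ _ _ _ r a _ hSF
  obtain ⟨c, β₂, S₁, hc, h⟩ := hSF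
  refine ⟨c, β₂, S₁, hc, fun A hA => ?_⟩
  obtain ⟨K, hK⟩ := h A hA
  obtain ⟨CA, hCA⟩ := A.bounded
  refine ⟨Real.exp K, fun β hβ S n hS hn => ?_⟩
  have hwin := latticeConnectedCorr_le_exp_mul_of_floor r (2 * S + 1) A.measurable A.measurable
    hCA hCA n (β := β) (l := c * a β * n - K) (fun b hb1 hb2 => hK β hβ S n hS hn b hb1 hb2)
  have hexp : Real.exp (-(c * a β * n - K)) = Real.exp K * Real.exp (-(c * a β * n)) := by
    rw [← Real.exp_add]; ring_nf
  rw [hexp] at hwin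
  exact hwin

end Summit.QuantumFields.YangMills.Cruxes.IR.BetaSlopeFloor

end
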